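import Literature.NumberTheory.Rogawski1990.ArchStableOrbitalWallPackageOfClause   -- (D0-2) (this seat): `wallCoef_hstep_of_clause`; brings (D0-1), ★ p841698, ★ p841638, ★ p841391
import Literature.NumberTheory.Rogawski1990.ArchStableOrbitalPlaceInduction       -- ★ p841576 (R1-e-core): the abstract place induction
import HarnessLib

/-!
# The wall constants as DATA, III: the two-carrier end-state identity with the side-`α` constants handed in ((D0-3) of (R1-h-d) «signed regrouping»; Rogawski 1990 §8.2 p. 122–124,
# §14.5 p. 238–239)

Topic `NumberTheory/Rogawski1990`; namespace `Literature.NumberTheory.Rogawski1990`.  THEOREMS ONLY (no `def`, no instance, no notation, no axiom, no named fact, no `sorry`).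
Cell `pub/hodgecm-mathlib`, ENGINE T1 (crux H413 = `stmt-HodgeConjecture-24833`); floor-2 road «(J-nc) in-house», brick (D0-3) of (R1-h-d) (LEAD F0P3a-plan (g9) WORD T8-119∕T8-120;
census `F0/P3a` bus 07:08:19Z, F0P3-p03 (g9) «=» 07:08:40Z); author F0P3a-p07 (g8), 2026-09-01.

WHAT.  ★ (R1-e-two) p841776 `exists_wallCoef_sum_prod_mul_eq_of_regular_eq` with the side-`α` wall constants as DATA: **`wallCoef_sum_prod_mul_eq_of_regular_eq_of_clause`** takes
`(c : W → Perm (Fin 3) → ℂ)` and, AFTER the statement-level instances, the hypothesis that `c v τ` satisfies the (J-nc) clause of ★ `ArchLimitFormulaNoncompactWall` on `G_v(α∘τ)` at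
`(ντ v τ, z₁ v, νH v τ)` for every place `v` and every `τ` with a noncompact `{0,2}`-wall, and concludes the SAME two-carrier identity with `κ_v(ρ) = (cw ? 2 : c v ρ⁻¹)` for THIS `c`.
Side `β` stays abstract (`κ′, Wm′, hWm′, hstep′` — produce them with (D0-2) `wallCoef_hstep_of_clause` on the `β`-carrier to keep both carriers' constants named).  Proof = ★ p841776's
with `obtain ⟨c, hc, hWm, hstep⟩ := exists_wallCoef_hstep …` replaced by `obtain ⟨hWm, hstep⟩ := wallCoef_hstep_of_clause … c hcl`.
HONEST LABEL: HC_CM is proved only modulo the 7 printed citations until rung 0 closes; this file re-threads a ★ proof and pays nothing by itself.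

## References
* [Rogawski1990] J. D. Rogawski, *Automorphic Representations of Unitary Groups in Three Variables*, Ann. of Math. Stud. 123 (1990), §8.2 p. 122–124, §14.5 p. 238–239.
* [Varadarajan1989] V. S. Varadarajan, *An Introduction to Harmonic Analysis on Semisimple Lie Groups* (1989), §6.4 Thm 22.
* [BorelJacquet1979] A. Borel, H. Jacquet, *Automorphic forms and automorphic representations*, PSPM 33.1 (1979), §4.1.
-/

set_option autoImplicit false

noncomputable section

open MeasureTheory Measure Filter Topology NumberField NumberField.InfinitePlace NumberField.mixedEmbedding Equiv Function Set
open Literature.MeasureTheory.Group Literature.NumberTheory.Automorphic Literature.NumberTheory.Automorphic.UnitaryGroup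
open Literature.LinearAlgebra.Matrix
open scoped Matrix MatrixGroups Matrix.Norms.Operator ContDiff

namespace Literature.NumberTheory.Rogawski1990

variable (L : Type) [Field L] [NumberField L] [IsCMField L] (α β : Fin 3 → L)
  [MeasurableSpace (GL (Fin 3) ℂ)] [BorelSpace (GL (Fin 3) ℂ)]
  [MeasurableSpace (arch (↥(maximalRealSubfield L)) L (IsCMField.complexConj L) 3 (Matrix.diagonal α))] [BorelSpace (arch (↥(maximalRealSubfield L)) L (IsCMField.complexConj L) 3 (Matrix.diagonal α))]

open scoped Classical in
/-- **(R1-e-two)′ EQUAL REGULAR ORBIT-MEASURE STATES ⇒ EQUAL WALL END STATES, WITH THE SIDE-`α` WALL CONSTANTS AS DATA** (clause-threaded form of ★ (R1-e-two) p841776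
`exists_wallCoef_sum_prod_mul_eq_of_regular_eq`: same statement with the side-`α` constants `c v τ` HANDED IN together with the (J-nc) clause they satisfy at every place `v` and every
relabelling `τ` with a noncompact `{0,2}`-wall — on `G_v(α∘τ)` at the data `(ντ v τ, z₁ v, νH v τ)`, the `hc` binder of ★ (b1) p842004 verbatim — instead of `∃ c, (c ≠ 0) ∧ …`; side `β`
abstract as before; proof = ★ p841776's over (D0-2) `wallCoef_hstep_of_clause` and ★ p841576).  CONCLUSION: `Σ_ρ (Π_v κ_v(ρ_v))·(K_α⁻¹ ∫ Θ d(⊗_v Wm_v(ρ_v))) = Σ_ρ (Π_v κ′_v(ρ_v))·(K_β⁻¹ ∫ Θ′ d(⊗_v Wm′_v(ρ_v)))`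
with `κ_v(ρ) = (cw ? 2 : c v ρ⁻¹)` for THIS `c` — so that (R1-h-d) can compare the `c v τ` across `τ` ((b1) ★ p842004, (b2′) ★ p842051, ★ p841778) and evaluate them ((J-val)).
[cite: Rogawski1990, §8.2 p. 124; §14.5 p. 238–239] [cite: Varadarajan1989, §6.4 Thm 22] [cite: BorelJacquet1979, §4.1] -/
theorem wallCoef_sum_prod_mul_eq_of_regular_eq_of_clause
    (z0 : {w : InfinitePlace L // IsComplex w} → Fin 3 → Circle) (hwall : ∀ v, z0 v 0 = z0 v 2 ∧ z0 v 0 ≠ z0 v 1)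
    -- side `α` (explicit, as in ★ p841698)
    (hα : ∀ i, α i ≠ 0) (hherm : ∀ i, (IsCMField.complexConj L (α i) : L) = α i)
    (νw : ∀ v : {w : InfinitePlace L // IsComplex w}, Measure (archLocal L 3 (Matrix.diagonal α) v)) (hνw : ∀ v, (νw v).IsHaarMeasure ∧ (νw v).IsMulRightInvariant)
    (z₁ : {w : InfinitePlace L // IsComplex w} → Fin 3 → Circle) (h02 : ∀ v, z₁ v 0 = z₁ v 2) (h01 : ∀ v, z₁ v 0 ≠ z₁ v 1)
    [∀ (v : {w : InfinitePlace L // IsComplex w}) (τ : Perm (Fin 3)), MeasurableSpace (archLocal L 3 (Matrix.diagonal (α ∘ ⇑τ)) v ⧸ Subgroup.centralizer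
      ({(⟨circleDiagonal 3 (z₁ v), circleDiagonal_mem_archLocal_diagonal L 3 (α ∘ ⇑τ) v (z₁ v)⟩ : archLocal L 3 (Matrix.diagonal (α ∘ ⇑τ)) v)} :
        Set (archLocal L 3 (Matrix.diagonal (α ∘ ⇑τ)) v)))]
    [∀ (v : {w : InfinitePlace L // IsComplex w}) (τ : Perm (Fin 3)), BorelSpace (archLocal L 3 (Matrix.diagonal (α ∘ ⇑τ)) v ⧸ Subgroup.centralizer
      ({(⟨circleDiagonal 3 (z₁ v), circleDiagonal_mem_archLocal_diagonal L 3 (α ∘ ⇑τ) v (z₁ v)⟩ : archLocal L 3 (Matrix.diagonal (α ∘ ⇑τ)) v)} :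
        Set (archLocal L 3 (Matrix.diagonal (α ∘ ⇑τ)) v)))]
    (νH : ∀ (v : {w : InfinitePlace L // IsComplex w}) (τ : Perm (Fin 3)), Measure (Subgroup.centralizer
      ({(⟨circleDiagonal 3 (z₁ v), circleDiagonal_mem_archLocal_diagonal L 3 (α ∘ ⇑τ) v (z₁ v)⟩ : archLocal L 3 (Matrix.diagonal (α ∘ ⇑τ)) v)} :
        Set (archLocal L 3 (Matrix.diagonal (α ∘ ⇑τ)) v))))
    (hνH : ∀ v τ, (νH v τ).IsHaarMeasure ∧ (νH v τ).IsInvInvariant)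
    (ντ : ∀ (v : {w : InfinitePlace L // IsComplex w}) (τ : Perm (Fin 3)), Measure (archLocal L 3 (Matrix.diagonal (α ∘ ⇑τ)) v))
    (hντi : ∀ v τ, (ντ v τ).IsHaarMeasure ∧ (ντ v τ).IsMulRightInvariant)
    (hντ : ντ = fun v τ => (νw v).map (ContinuousMulEquiv.restrictSubgroup (GLn.conjEquiv (Matrix.GeneralLinearGroup.mkOfDetNeZero _ (det_monomial_one_ne_zero 3 τ)))
              (archLocal L 3 (Matrix.diagonal (α ∘ ⇑τ)) v) (archLocal L 3 (Matrix.diagonal α) v)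
              (mem_archLocal_comp_perm_iff_conj_mem L 3 α v τ)).symm)
    (Θ : Matrix (Fin 3) (Fin 3) (mixedSpace L) → ℂ) (hΘ : ContDiff ℝ (⊤ : ℕ∞) Θ)
    (hΘc : HasCompactSupport fun g : arch (↥(maximalRealSubfield L)) L (IsCMField.complexConj L) 3 (Matrix.diagonal α) => Θ ((g : GL (Fin 3) (mixedSpace L)) : Matrix (Fin 3) (Fin 3) (mixedSpace L)))
    (c : {w : InfinitePlace L // IsComplex w} → Perm (Fin 3) → ℂ)
    -- side `β` (per-place Haar measures, canonical family, test function; ABSTRACT wall data with ★ p841576's `hWm′`, `hstep′`)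
    (hβ : ∀ i, β i ≠ 0)
    (νw' : ∀ v : {w : InfinitePlace L // IsComplex w}, Measure (archLocal L 3 (Matrix.diagonal β) v)) (hνw' : ∀ v, (νw' v).IsHaarMeasure ∧ (νw' v).IsMulRightInvariant)
    (Θ' : Matrix (Fin 3) (Fin 3) (mixedSpace L) → ℂ)
    (κ' : {w : InfinitePlace L // IsComplex w} → Perm (Fin 3) → ℂ) (Wm' : ∀ v : {w : InfinitePlace L // IsComplex w}, Perm (Fin 3) → Measure (archLocal L 3 (Matrix.diagonal β) v))
    (hWm' : ∀ v ρ, IsFiniteMeasureOnCompacts (Wm' v ρ) ∧ SigmaFinite (Wm' v ρ))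
    (hstep' : ∀ (w : {w : InfinitePlace L // IsComplex w}) (ι : Type) [Fintype ι] (s : ι → ℂ) (μ : ι → ∀ v : {w : InfinitePlace L // IsComplex w}, Measure (archLocal L 3 (Matrix.diagonal β) v)),
        (∀ i v, IsFiniteMeasureOnCompacts (μ i v) ∧ SigmaFinite (μ i v)) →
        Tendsto (fun ψ : ℝ => deriv (fun ψ : ℝ => (2 * Real.sin ψ : ℂ) * ∑ i, s i * ∑ ρ : Perm (Fin 3),
            (((∏ v : {w : InfinitePlace L // IsComplex w},
            (Finset.univ.filter fun i => 0 < (v.1.embedding (β i)).re).card.factorial *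
              (3 - (Finset.univ.filter fun i => 0 < (v.1.embedding (β i)).re).card).factorial : ℕ) : ℂ)⁻¹ *
                ∫ o, Θ' ((((archPiEquivCM 3 L (Matrix.diagonal β)).symm o : arch (↥(maximalRealSubfield L)) L (IsCMField.complexConj L) 3 (Matrix.diagonal β)) : GL (Fin 3) (mixedSpace L)) : Matrix (Fin 3) (Fin 3) (mixedSpace L)) ∂(Measure.pi (Function.update (μ i) w ((νw' w).map fun y : archLocal L 3 (Matrix.diagonal β) w => y * (⟨circleDiagonal 3 ((fun j => z0 w j * Circle.exp (![(1 : ℝ), 0, -1] j * ψ)) ∘ ⇑ρ), circleDiagonal_mem_archLocal_diagonal L 3 β w ((fun j => z0 w j * Circle.exp (![(1 : ℝ), 0, -1] j * ψ)) ∘ ⇑ρ)⟩ : archLocal L 3 (Matrix.diagonal β) w) * y⁻¹))))) ψ)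
          (𝓝[>] 0)
          (𝓝 (∑ i, s i * ∑ ρ : Perm (Fin 3), κ' w ρ * (((∏ v : {w : InfinitePlace L // IsComplex w},
            (Finset.univ.filter fun i => 0 < (v.1.embedding (β i)).re).card.factorial *
              (3 - (Finset.univ.filter fun i => 0 < (v.1.embedding (β i)).re).card).factorial : ℕ) : ℂ)⁻¹ *
                ∫ o, Θ' ((((archPiEquivCM 3 L (Matrix.diagonal β)).symm o : arch (↥(maximalRealSubfield L)) L (IsCMField.complexConj L) 3 (Matrix.diagonal β)) : GL (Fin 3) (mixedSpace L)) : Matrix (Fin 3) (Fin 3) (mixedSpace L)) ∂(Measure.pi (Function.update (μ i) w (Wm' w ρ)))))))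
    -- the regular identity in orbit-measure currency (★ p841429 (R1-0) turns `Φ^st_m(t_α(z), Θ∘coe) = Φ^st_{m′}(t_β(z), Θ′∘coe)` into it)
    (hreg : ∀ z : {w : InfinitePlace L // IsComplex w} → Fin 3 → Circle, (∀ v, Function.Injective (z v)) →
      ∑ ρ : {w : InfinitePlace L // IsComplex w} → Perm (Fin 3), ((∏ v : {w : InfinitePlace L // IsComplex w},
            (Finset.univ.filter fun i => 0 < (v.1.embedding (α i)).re).card.factorial *
              (3 - (Finset.univ.filter fun i => 0 < (v.1.embedding (α i)).re).card).factorial : ℕ) : ℂ)⁻¹ *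
          ∫ o, Θ ((((archPiEquivCM 3 L (Matrix.diagonal α)).symm o : arch (↥(maximalRealSubfield L)) L (IsCMField.complexConj L) 3 (Matrix.diagonal α)) : GL (Fin 3) (mixedSpace L)) : Matrix (Fin 3) (Fin 3) (mixedSpace L))
            ∂(Measure.pi fun v : {w : InfinitePlace L // IsComplex w} => (νw v).map fun y : archLocal L 3 (Matrix.diagonal α) v =>
              y * (⟨circleDiagonal 3 (z v ∘ ⇑(ρ v)), circleDiagonal_mem_archLocal_diagonal L 3 α v (z v ∘ ⇑(ρ v))⟩ : archLocal L 3 (Matrix.diagonal α) v) * y⁻¹) =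
      ∑ ρ : {w : InfinitePlace L // IsComplex w} → Perm (Fin 3), ((∏ v : {w : InfinitePlace L // IsComplex w},
            (Finset.univ.filter fun i => 0 < (v.1.embedding (β i)).re).card.factorial *
              (3 - (Finset.univ.filter fun i => 0 < (v.1.embedding (β i)).re).card).factorial : ℕ) : ℂ)⁻¹ *
          ∫ o, Θ' ((((archPiEquivCM 3 L (Matrix.diagonal β)).symm o : arch (↥(maximalRealSubfield L)) L (IsCMField.complexConj L) 3 (Matrix.diagonal β)) : GL (Fin 3) (mixedSpace L)) : Matrix (Fin 3) (Fin 3) (mixedSpace L))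
            ∂(Measure.pi fun v : {w : InfinitePlace L // IsComplex w} => (νw' v).map fun y : archLocal L 3 (Matrix.diagonal β) v =>
              y * (⟨circleDiagonal 3 (z v ∘ ⇑(ρ v)), circleDiagonal_mem_archLocal_diagonal L 3 β v (z v ∘ ⇑(ρ v))⟩ : archLocal L 3 (Matrix.diagonal β) v) * y⁻¹)) :
    haveI : ∀ (v : {w : InfinitePlace L // IsComplex w}) (τ : Perm (Fin 3)), LocallyCompactSpace (archLocal L 3 (Matrix.diagonal (α ∘ ⇑τ)) v) := fun v τ => locallyCompactSpace_archLocal L 3 (Matrix.diagonal (α ∘ ⇑τ)) v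
    haveI : ∀ (v : {w : InfinitePlace L // IsComplex w}) (τ : Perm (Fin 3)), SecondCountableTopology (archLocal L 3 (Matrix.diagonal (α ∘ ⇑τ)) v) := fun v τ => secondCountableTopology_archLocal L 3 (Matrix.diagonal (α ∘ ⇑τ)) v
    haveI : ∀ (v : {w : InfinitePlace L // IsComplex w}) (τ : Perm (Fin 3)), (νH v τ).IsHaarMeasure := fun v τ => (hνH v τ).1
    haveI : ∀ (v : {w : InfinitePlace L // IsComplex w}) (τ : Perm (Fin 3)), (νH v τ).IsInvInvariant := fun v τ => (hνH v τ).2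
    haveI : ∀ (v : {w : InfinitePlace L // IsComplex w}) (τ : Perm (Fin 3)), (ντ v τ).IsHaarMeasure := fun v τ => (hντi v τ).1
    haveI : ∀ (v : {w : InfinitePlace L // IsComplex w}) (τ : Perm (Fin 3)), (ντ v τ).IsMulRightInvariant := fun v τ => (hντi v τ).2
    (∀ (v : {w : InfinitePlace L // IsComplex w}), ∀ (τ : Perm (Fin 3)), (v.1.embedding (α (τ 0))).re * (v.1.embedding (α (τ 2))).re < 0 →
      ∀ (Θ : Matrix (Fin 3) (Fin 3) ℂ → ℂ), ContDiff ℝ (⊤ : ℕ∞) Θ →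
        HasCompactSupport (fun k : archLocal L 3 (Matrix.diagonal (α ∘ ⇑τ)) v => Θ ((k : GL (Fin 3) ℂ) : Matrix (Fin 3) (Fin 3) ℂ)) →
        ∀ (z₀ : Fin 3 → Circle) (h02' : z₀ 0 = z₀ 2) (h01' : z₀ 0 ≠ z₀ 1),
          Tendsto (fun ψ : ℝ => deriv (fun ψ : ℝ => (2 * Real.sin ψ : ℂ) *
              ∫ g, Θ (((g * ⟨circleDiagonal 3 (fun i => z₀ i * Circle.exp (![(1 : ℝ), 0, -1] i * ψ)),
                circleDiagonal_mem_archLocal_diagonal L 3 (α ∘ ⇑τ) v _⟩ * g⁻¹ : archLocal L 3 (Matrix.diagonal (α ∘ ⇑τ)) v) : GL (Fin 3) ℂ) : Matrix (Fin 3) (Fin 3) ℂ)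
                ∂(ντ v τ)) ψ)
            (𝓝[≠] 0)
            (𝓝 (c v τ * ∫ y, descConj (⟨circleDiagonal 3 z₀, circleDiagonal_mem_archLocal_diagonal L 3 (α ∘ ⇑τ) v z₀⟩ : archLocal L 3 (Matrix.diagonal (α ∘ ⇑τ)) v)
              (Subgroup.centralizer ({(⟨circleDiagonal 3 (z₁ v), circleDiagonal_mem_archLocal_diagonal L 3 (α ∘ ⇑τ) v (z₁ v)⟩ : archLocal L 3 (Matrix.diagonal (α ∘ ⇑τ)) v)} :
                Set (archLocal L 3 (Matrix.diagonal (α ∘ ⇑τ)) v)))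
              (forall_mem_centralizer_circleDiagonal_comm_of_wall L (α ∘ ⇑τ) v (h02 v) (h01 v) h02' h01')
              (fun k : archLocal L 3 (Matrix.diagonal (α ∘ ⇑τ)) v => Θ ((k : GL (Fin 3) ℂ) : Matrix (Fin 3) (Fin 3) ℂ)) y
              ∂(quotientMeasure _ (νH v τ) (isClosed_coe_centralizer_singleton _)
                (ντ v τ))))) →
      ∑ ρ : {w : InfinitePlace L // IsComplex w} → Perm (Fin 3), (∏ v, (if 0 < (v.1.embedding (α ((ρ v)⁻¹ 0))).re * (v.1.embedding (α ((ρ v)⁻¹ 2))).re then (2 : ℂ) else c v (ρ v)⁻¹)) *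
          (((∏ v : {w : InfinitePlace L // IsComplex w},
            (Finset.univ.filter fun i => 0 < (v.1.embedding (α i)).re).card.factorial *
              (3 - (Finset.univ.filter fun i => 0 < (v.1.embedding (α i)).re).card).factorial : ℕ) : ℂ)⁻¹ *
                ∫ o, Θ ((((archPiEquivCM 3 L (Matrix.diagonal α)).symm o : arch (↥(maximalRealSubfield L)) L (IsCMField.complexConj L) 3 (Matrix.diagonal α)) : GL (Fin 3) (mixedSpace L)) : Matrix (Fin 3) (Fin 3) (mixedSpace L)) ∂(Measure.pi (fun v : {w : InfinitePlace L // IsComplex w} =>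
              (if 0 < (v.1.embedding (α ((ρ v)⁻¹ 0))).re * (v.1.embedding (α ((ρ v)⁻¹ 2))).re then (νw v).map fun y : archLocal L 3 (Matrix.diagonal α) v => y * (⟨circleDiagonal 3 (z0 v ∘ ⇑(ρ v)), circleDiagonal_mem_archLocal_diagonal L 3 α v (z0 v ∘ ⇑(ρ v))⟩ : archLocal L 3 (Matrix.diagonal α) v) * y⁻¹
              else ((quotientMeasure _ (νH v (ρ v)⁻¹) (isClosed_coe_centralizer_singleton _) (ντ v (ρ v)⁻¹)).map
                (descConj (⟨circleDiagonal 3 (z0 v), circleDiagonal_mem_archLocal_diagonal L 3 (α ∘ ⇑(ρ v)⁻¹) v (z0 v)⟩ : archLocal L 3 (Matrix.diagonal (α ∘ ⇑(ρ v)⁻¹)) v)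
                  (Subgroup.centralizer ({(⟨circleDiagonal 3 (z₁ v), circleDiagonal_mem_archLocal_diagonal L 3 (α ∘ ⇑(ρ v)⁻¹) v (z₁ v)⟩ :
                    archLocal L 3 (Matrix.diagonal (α ∘ ⇑(ρ v)⁻¹)) v)} : Set (archLocal L 3 (Matrix.diagonal (α ∘ ⇑(ρ v)⁻¹)) v)))
                  (forall_mem_centralizer_circleDiagonal_comm_of_wall L (α ∘ ⇑(ρ v)⁻¹) v (h02 v) (h01 v) (hwall v).1 (hwall v).2) id)).map
                (ContinuousMulEquiv.restrictSubgroup (GLn.conjEquiv (Matrix.GeneralLinearGroup.mkOfDetNeZero _ (det_monomial_one_ne_zero 3 (ρ v)⁻¹)))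
              (archLocal L 3 (Matrix.diagonal (α ∘ ⇑(ρ v)⁻¹)) v) (archLocal L 3 (Matrix.diagonal α) v)
              (mem_archLocal_comp_perm_iff_conj_mem L 3 α v (ρ v)⁻¹)))))) =
      ∑ ρ : {w : InfinitePlace L // IsComplex w} → Perm (Fin 3), (∏ v, κ' v (ρ v)) *
          (((∏ v : {w : InfinitePlace L // IsComplex w},
            (Finset.univ.filter fun i => 0 < (v.1.embedding (β i)).re).card.factorial *
              (3 - (Finset.univ.filter fun i => 0 < (v.1.embedding (β i)).re).card).factorial : ℕ) : ℂ)⁻¹ *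
                ∫ o, Θ' ((((archPiEquivCM 3 L (Matrix.diagonal β)).symm o : arch (↥(maximalRealSubfield L)) L (IsCMField.complexConj L) 3 (Matrix.diagonal β)) : GL (Fin 3) (mixedSpace L)) : Matrix (Fin 3) (Fin 3) (mixedSpace L)) ∂(Measure.pi (fun v : {w : InfinitePlace L // IsComplex w} => Wm' v (ρ v)))) := by
  classical
  haveI hH1 : ∀ (v : {w : InfinitePlace L // IsComplex w}) (τ : Perm (Fin 3)), (νH v τ).IsHaarMeasure := fun v τ => (hνH v τ).1
  haveI hH2 : ∀ (v : {w : InfinitePlace L // IsComplex w}) (τ : Perm (Fin 3)), (νH v τ).IsInvInvariant := fun v τ => (hνH v τ).2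
  haveI hT1 : ∀ (v : {w : InfinitePlace L // IsComplex w}) (τ : Perm (Fin 3)), (ντ v τ).IsHaarMeasure := fun v τ => (hντi v τ).1
  haveI hT2 : ∀ (v : {w : InfinitePlace L // IsComplex w}) (τ : Perm (Fin 3)), (ντ v τ).IsMulRightInvariant := fun v τ => (hντi v τ).2
  haveI hLC : ∀ (v : {w : InfinitePlace L // IsComplex w}) (τ : Perm (Fin 3)), LocallyCompactSpace (archLocal L 3 (Matrix.diagonal (α ∘ ⇑τ)) v) :=
    fun v τ => locallyCompactSpace_archLocal L 3 (Matrix.diagonal (α ∘ ⇑τ)) v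
  haveI hSC : ∀ (v : {w : InfinitePlace L // IsComplex w}) (τ : Perm (Fin 3)), SecondCountableTopology (archLocal L 3 (Matrix.diagonal (α ∘ ⇑τ)) v) :=
    fun v τ => secondCountableTopology_archLocal L 3 (Matrix.diagonal (α ∘ ⇑τ)) v
  haveI hLCv : ∀ v : {w : InfinitePlace L // IsComplex w}, LocallyCompactSpace (archLocal L 3 (Matrix.diagonal α) v) := fun v => locallyCompactSpace_archLocal L 3 (Matrix.diagonal α) v
  haveI hSCv : ∀ v : {w : InfinitePlace L // IsComplex w}, SecondCountableTopology (archLocal L 3 (Matrix.diagonal α) v) := fun v => secondCountableTopology_archLocal L 3 (Matrix.diagonal α) v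
  haveI hLCv' : ∀ v : {w : InfinitePlace L // IsComplex w}, LocallyCompactSpace (archLocal L 3 (Matrix.diagonal β) v) := fun v => locallyCompactSpace_archLocal L 3 (Matrix.diagonal β) v
  haveI hSCv' : ∀ v : {w : InfinitePlace L // IsComplex w}, SecondCountableTopology (archLocal L 3 (Matrix.diagonal β) v) := fun v => secondCountableTopology_archLocal L 3 (Matrix.diagonal β) v
  -- the side-`α` package with THIS `c` ((D0-2) `wallCoef_hstep_of_clause`)
  intro hcl
  obtain ⟨hWm, hstep⟩ := wallCoef_hstep_of_clause L α hα hherm z0 hwall νw hνw z₁ h02 h01 νH hνH ντ hντi hντ Θ hΘ hΘc c hcl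
  -- the place induction (★ p841576)
  have key := PlaceInduction.sum_prod_mul_eq_of_step_of_regular_eq
    (fun (v : {w : InfinitePlace L // IsComplex w}) (μ : Measure (archLocal L 3 (Matrix.diagonal α) v)) => IsFiniteMeasureOnCompacts μ ∧ SigmaFinite μ)
    (fun (v : {w : InfinitePlace L // IsComplex w}) (μ : Measure (archLocal L 3 (Matrix.diagonal β) v)) => IsFiniteMeasureOnCompacts μ ∧ SigmaFinite μ)
    (fun μ : ∀ v : {w : InfinitePlace L // IsComplex w}, Measure (archLocal L 3 (Matrix.diagonal α) v) => ((∏ v : {w : InfinitePlace L // IsComplex w},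
            (Finset.univ.filter fun i => 0 < (v.1.embedding (α i)).re).card.factorial *
              (3 - (Finset.univ.filter fun i => 0 < (v.1.embedding (α i)).re).card).factorial : ℕ) : ℂ)⁻¹ *
          ∫ o, Θ ((((archPiEquivCM 3 L (Matrix.diagonal α)).symm o : arch (↥(maximalRealSubfield L)) L (IsCMField.complexConj L) 3 (Matrix.diagonal α)) :
              GL (Fin 3) (mixedSpace L)) : Matrix (Fin 3) (Fin 3) (mixedSpace L)) ∂(Measure.pi μ))
    (fun μ : ∀ v : {w : InfinitePlace L // IsComplex w}, Measure (archLocal L 3 (Matrix.diagonal β) v) => ((∏ v : {w : InfinitePlace L // IsComplex w},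
            (Finset.univ.filter fun i => 0 < (v.1.embedding (β i)).re).card.factorial *
              (3 - (Finset.univ.filter fun i => 0 < (v.1.embedding (β i)).re).card).factorial : ℕ) : ℂ)⁻¹ *
          ∫ o, Θ' ((((archPiEquivCM 3 L (Matrix.diagonal β)).symm o : arch (↥(maximalRealSubfield L)) L (IsCMField.complexConj L) 3 (Matrix.diagonal β)) :
              GL (Fin 3) (mixedSpace L)) : Matrix (Fin 3) (Fin 3) (mixedSpace L)) ∂(Measure.pi μ))
    (fun (v : {w : InfinitePlace L // IsComplex w}) (u : Fin 3 → Circle) => (νw v).map fun y : archLocal L 3 (Matrix.diagonal α) v =>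
      y * (⟨circleDiagonal 3 u, circleDiagonal_mem_archLocal_diagonal L 3 α v u⟩ : archLocal L 3 (Matrix.diagonal α) v) * y⁻¹)
    (fun (v : {w : InfinitePlace L // IsComplex w}) (u : Fin 3 → Circle) => (νw' v).map fun y : archLocal L 3 (Matrix.diagonal β) v =>
      y * (⟨circleDiagonal 3 u, circleDiagonal_mem_archLocal_diagonal L 3 β v u⟩ : archLocal L 3 (Matrix.diagonal β) v) * y⁻¹)
    (fun (v : {w : InfinitePlace L // IsComplex w}) (ρ : Perm (Fin 3)) =>
      (if 0 < (v.1.embedding (α (ρ⁻¹ 0))).re * (v.1.embedding (α (ρ⁻¹ 2))).re then (νw v).map fun y : archLocal L 3 (Matrix.diagonal α) v => y * (⟨circleDiagonal 3 (z0 v ∘ ⇑ρ), circleDiagonal_mem_archLocal_diagonal L 3 α v (z0 v ∘ ⇑ρ)⟩ : archLocal L 3 (Matrix.diagonal α) v) * y⁻¹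
              else ((quotientMeasure _ (νH v ρ⁻¹) (isClosed_coe_centralizer_singleton _) (ντ v ρ⁻¹)).map
                (descConj (⟨circleDiagonal 3 (z0 v), circleDiagonal_mem_archLocal_diagonal L 3 (α ∘ ⇑ρ⁻¹) v (z0 v)⟩ : archLocal L 3 (Matrix.diagonal (α ∘ ⇑ρ⁻¹)) v)
                  (Subgroup.centralizer ({(⟨circleDiagonal 3 (z₁ v), circleDiagonal_mem_archLocal_diagonal L 3 (α ∘ ⇑ρ⁻¹) v (z₁ v)⟩ :
                    archLocal L 3 (Matrix.diagonal (α ∘ ⇑ρ⁻¹)) v)} : Set (archLocal L 3 (Matrix.diagonal (α ∘ ⇑ρ⁻¹)) v)))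
                  (forall_mem_centralizer_circleDiagonal_comm_of_wall L (α ∘ ⇑ρ⁻¹) v (h02 v) (h01 v) (hwall v).1 (hwall v).2) id)).map
                (ContinuousMulEquiv.restrictSubgroup (GLn.conjEquiv (Matrix.GeneralLinearGroup.mkOfDetNeZero _ (det_monomial_one_ne_zero 3 ρ⁻¹)))
              (archLocal L 3 (Matrix.diagonal (α ∘ ⇑ρ⁻¹)) v) (archLocal L 3 (Matrix.diagonal α) v)
              (mem_archLocal_comp_perm_iff_conj_mem L 3 α v ρ⁻¹))))
    Wm'
    (fun (v : {w : InfinitePlace L // IsComplex w}) (ρ : Perm (Fin 3)) => (if 0 < (v.1.embedding (α (ρ⁻¹ 0))).re * (v.1.embedding (α (ρ⁻¹ 2))).re then (2 : ℂ) else c v ρ⁻¹))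
    κ' z0 hwall
    (fun v u hu => by
      haveI : IsFiniteMeasureOnCompacts (νw v) := (hνw v).1.toIsFiniteMeasureOnCompacts
      exact isFiniteMeasureOnCompacts_and_sigmaFinite_map_conj_of_injective L α hα v (νw v) u hu)
    (fun v u hu => by
      haveI : IsFiniteMeasureOnCompacts (νw' v) := (hνw' v).1.toIsFiniteMeasureOnCompacts
      exact isFiniteMeasureOnCompacts_and_sigmaFinite_map_conj_of_injective L β hβ v (νw' v) u hu)
    hWm hWm' hstep hstep' hreg
  simpa only using key

end Literature.NumberTheory.Rogawski1990

end
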